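import Summits.BirchSwinnertonDyer.Rank1Residual.GaloisImage.PropagatedStructure
import Literature.NumberTheory.EllipticCurves.KummerSelmerStructure
import Literature.NumberTheory.EllipticCurves.PointDivisibilityProofs
import HarnessLib

/-!
# The local Kummer condition lies in Mazur–Rubin's propagated structure:
# `im(E(ℚ_v)/p^{k+1} → H¹(ℚ_v, E[p^{k+1}])) ≤ im(H¹(ℚ_v, T_pE) → H¹(ℚ_v, E[p^{k+1}]))` at every place
# (cell `b2b-bsdres`, team n1011, sub-target T-a3-F1 hypothesis side — the input of residual
# coisotropy, lead R5-3 / R5-8; §I item N11; seat p13)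

HONEST FRAMING (cell `b2b-bsdres`, run/shared/lean/b2b/bsd-rank1-residual/, verbatim in every
file): the goal of the cell is to DELETE the COMBINATION-SHAPED residual classes of the
Birch–Swinnerton-Dyer formula for ALL analytic-rank `≤ 1` elliptic curves over `ℚ` — "full BSD
formula for every rank `≤ 1` curve in class `C`" assembled STRICTLY from published theorems — so
that the rank-`≤ 1` remainder becomes exactly the CONSTRUCTION-SHAPED classes, which are TYPED
(missing-input `Prop`s), NOT attempted. This is not "finishing BSD". Team n1011: prove what is
provable now; no claim beyond stated classes. Our own theorems; the only definitions are the
explicit `p`-division sequence and the Tate-module-valued Kummer cocycle used in the proof; no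
named fact; nothing is booked; no label changes.

## What and why

Sakamoto's Thm. 4.4 (JTNB 36 (2024)) wants `𝓕` residually coisotropic (Def. 3.8: `𝓕̄* ≤ 𝓕̄`). For
the N11 instance `𝓕̄ = propagatedSelmerStructureOne W p = im(H¹(ℚ_v, T_pE) → H¹(ℚ_v, E[p]))`
(`PropagatedStructureCartesian.induced_propagatedSelmerStructure`), and the team's argument
(skel/T-a3.md v2 §6 (a); p18 lineage) is: `𝓕̄_v ⊇` the local KUMMER condition
`im(E(ℚ_v)/p → H¹(ℚ_v, E[p]))`, which is maximal isotropic for the local Tate pairing, hence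
`𝓕̄_v* ⊆ Kummer* = Kummer ⊆ 𝓕̄_v`. This file supplies the inclusion, at every place and every level:

* `kummerSelmerStructure_le_propagatedSelmerStructureOne` — **`W.kummerSelmerStructure p v ≤
  propagatedSelmerStructureOne W p v` for every place `v`**; `kummerSelmerStructure_le_propagatedSelmerStructure`
  — the level-`p^{k+1}` form `W.kummerSelmerStructure (p^k·p) v ≤ propagatedSelmerStructure W p k v`.
  PROOF: a local Kummer class is `κ_v(Q) = [σ ↦ θ⁻¹(σQ − Q)]` for `Q ∈ E(ℚ̄_v)` with `n Q ∈ E(ℚ_v)`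
  (tree `localKummerClass`, `mem_kummerLocalConditionAt_iff_exists_eq_localKummerClass`); choose a
  `p`-DIVISION SEQUENCE `R_0 = nQ, p R_{m+1} = R_m` in `E(ℚ̄_v)` (divisibility,
  `zsmul_surjective_of_isAlgClosed`); then `σ ↦ (θ_{p^m}⁻¹(σ R_m − R_m))_m` is a continuous crossed
  homomorphism `Γ_{ℚ_v} → T_pE` (`kummerLiftCocycle`) whose push-forward under `π_{k+1}` is the
  Kummer cocycle of `R_{k+1}`, and `κ_v(R_{k+1}) = κ_v(Q)` because `p^{k+1} R_{k+1} = nQ`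
  (`localKummerClass_eq_of_zsmul_eq`).
* Glue: `divSeq` (the chosen division sequence) with `p_zsmul_divSeq_succ`, `pow_zsmul_divSeq`;
  `kummerLiftCocycle` with `proj_kummerLiftCocycle`; the push-forward formulas
  `tateLocalMap_kummerLiftCocycle`, `tateLocalMapOne_kummerLiftCocycle`.

What is NOT here: the reverse inclusion / the identification of `𝓕_can` with the Kummer condition
at `ℓ ≠ p`, maximal isotropy and the coisotropy conclusion (p18 lineage), anything at `p = ∞`-specific.

References: R. Sakamoto, JTNB 36 (2024) Def. 3.8 (p. 924) [Sakamoto2024]; K. Rubin, PCMS 18 (2011)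
§3.1 (p. 29) [Rubin2011]; J. H. Silverman, *AEC* VIII.§2 (Kummer sequence), X.§4, III.§7
[SilvermanAEC2009]; J. S. Milne, *Arithmetic Duality Theorems* I.§6 [MilneADT2006].
-/

noncomputable section

open scoped Classical NumberField ContRepresentation
open Field NumberField IsDedekindDomain
open WeierstrassCurve Literature.NumberTheory.EllipticCurves Literature.NumberTheory.GaloisRepresentations
  Literature.NumberTheory.GaloisRepresentations.DiscreteGaloisModule

namespace Summit.BirchSwinnertonDyer.Rank1Residual.GaloisImage

variable (W : WeierstrassCurve ℚ) (p : ℕ) [hp : Fact p.Prime] [W.IsElliptic] (v : Place ℚ)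

/-! ### A chosen `p`-division sequence below a point of `E(ℚ̄_v)` -/

/-- A chosen **`p`-division sequence** below `P ∈ E(ℚ̄_v)`: `R_0 = P`, `p • R_{m+1} = R_m`
(divisibility of `E(ℚ̄_v)`, `zsmul_surjective_of_isAlgClosed`). Silverman, *AEC* VIII.§2. [folklore] -/
def divSeq (P : localPoints W (Place.Completion v)) : ℕ → localPoints W (Place.Completion v)
  | 0 => P
  | m + 1 => Classical.choose
      ((W.baseChange (AlgebraicClosure (Place.Completion v))).zsmul_surjective_of_isAlgClosed
        (Int.natCast_ne_zero.mpr hp.out.ne_zero : (p : ℤ) ≠ 0) (divSeq P m))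

/-- `R_0 = P`. [folklore] -/
@[simp] theorem divSeq_zero (P : localPoints W (Place.Completion v)) : divSeq W p v P 0 = P := rfl

/-- `p • R_{m+1} = R_m`. [folklore] -/
theorem p_zsmul_divSeq_succ (P : localPoints W (Place.Completion v)) (m : ℕ) :
    (p : ℤ) • divSeq W p v P (m + 1) = divSeq W p v P m :=
  Classical.choose_spec
    ((W.baseChange (AlgebraicClosure (Place.Completion v))).zsmul_surjective_of_isAlgClosed
      (Int.natCast_ne_zero.mpr hp.out.ne_zero : (p : ℤ) ≠ 0) (divSeq W p v P m))

/-- `p^m • R_m = P`. [folklore] -/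
theorem pow_zsmul_divSeq (P : localPoints W (Place.Completion v)) (m : ℕ) :
    ((p : ℤ) ^ m) • divSeq W p v P m = P := by
  induction m with
  | zero => rw [pow_zero, one_zsmul, divSeq_zero]
  | succ m ih => rw [pow_succ, mul_zsmul, p_zsmul_divSeq_succ, ih]

/-- For `P ∈ E(ℚ_v) = E(ℚ̄_v)^{Γ}`: `σ R_m − R_m ∈ E(ℚ̄_v)[p^m]`. [folklore] -/
theorem smul_divSeq_sub_mem (P : localPoints W (Place.Completion v))
    (hP : P ∈ MulAction.fixedPoints (absoluteGaloisGroup (Place.Completion v))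
      (localPoints W (Place.Completion v)))
    (σ : absoluteGaloisGroup (Place.Completion v)) (m : ℕ) :
    σ • divSeq W p v P m - divSeq W p v P m ∈
      AddSubgroup.torsionBy (localPoints W (Place.Completion v)) ((p ^ m : ℕ) : ℤ) := by
  change ((p ^ m : ℕ) : ℤ) • (σ • divSeq W p v P m - divSeq W p v P m) = 0
  rw [zsmul_sub, ← smul_zsmul_localPoints, Nat.cast_pow, pow_zsmul_divSeq, hP σ, sub_self]

/-! ### The Tate-module-valued Kummer cocycle -/

omit [W.IsElliptic] in
/-- `(p^m : ℤ) ≠ 0`. [folklore] -/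
theorem natCast_pow_ne_zero (m : ℕ) : ((p ^ m : ℕ) : ℤ) ≠ 0 := by
  exact_mod_cast pow_ne_zero m hp.out.ne_zero

/-- The `m`-th component `θ_{p^m}⁻¹(σ R_m − R_m) ∈ E[p^m](ℚ̄)` of the lifted Kummer cocycle, as a
geometric point (`θ` the torsion comparison `torsionPointsEquiv`). [folklore] -/
def kummerLiftSeq (P : localPoints W (Place.Completion v))
    (hP : P ∈ MulAction.fixedPoints (absoluteGaloisGroup (Place.Completion v))
      (localPoints W (Place.Completion v)))
    (σ : absoluteGaloisGroup (Place.Completion v)) (m : ℕ) : geomPoints W :=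
  (((W.torsionPointsEquiv ((p ^ m : ℕ) : ℤ) (E := Place.Completion v)
      (natCast_pow_ne_zero p m)).symm
    ⟨σ • divSeq W p v P m - divSeq W p v P m, smul_divSeq_sub_mem W p v P hP σ m⟩ :
      geomTorsion W ((p ^ m : ℕ) : ℤ)) : geomPoints W)

/-- `pointsMap` of the `m`-th component is `σ R_m − R_m`. [folklore] -/
@[simp] theorem pointsMap_kummerLiftSeq (P : localPoints W (Place.Completion v))
    (hP : P ∈ MulAction.fixedPoints (absoluteGaloisGroup (Place.Completion v))
      (localPoints W (Place.Completion v)))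
    (σ : absoluteGaloisGroup (Place.Completion v)) (m : ℕ) :
    pointsMap W (Place.Completion v) (kummerLiftSeq W p v P hP σ m) =
      σ • divSeq W p v P m - divSeq W p v P m :=
  W.pointsMap_torsionPointsEquiv_symm _ _ _

/-- The `m`-th component lies in `E[p^m]`. [folklore] -/
theorem kummerLiftSeq_mem (P : localPoints W (Place.Completion v))
    (hP : P ∈ MulAction.fixedPoints (absoluteGaloisGroup (Place.Completion v))
      (localPoints W (Place.Completion v)))
    (σ : absoluteGaloisGroup (Place.Completion v)) (m : ℕ) :
    kummerLiftSeq W p v P hP σ m ∈ geomTorsion W ((p ^ m : ℕ) : ℤ) :=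
  (((W.torsionPointsEquiv ((p ^ m : ℕ) : ℤ) (E := Place.Completion v)
      (natCast_pow_ne_zero p m)).symm _ : geomTorsion W ((p ^ m : ℕ) : ℤ))).2

omit hp [W.IsElliptic] in
/-- `pointsMap` is injective. [folklore] -/
theorem pointsMap_injective : Function.Injective (pointsMap W (Place.Completion v)) :=
  pointsMapOfEmb_injective W (closureEmb (K := ℚ) (Place.Completion v))

/-- **The lifted Kummer cocycle** `σ ↦ (θ_{p^m}⁻¹(σ R_m − R_m))_m : Γ_{ℚ_v} → T_pE` along the chosen
division sequence `(R_m)` below `P ∈ E(ℚ_v)`: a continuous crossed homomorphism for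
`tateLocalRep W p v`. Silverman, *AEC* VIII.§2 (Kummer pairing, passed to the limit). [folklore] -/
def kummerLiftCocycle (P : localPoints W (Place.Completion v))
    (hP : P ∈ MulAction.fixedPoints (absoluteGaloisGroup (Place.Completion v))
      (localPoints W (Place.Completion v))) :
    contOneCocycles (tateLocalRep W p v).toTopRep := by
  refine ⟨⟨fun σ => TateModule.mk (fun m => kummerLiftSeq W p v P hP σ m)
      (fun m => ?_) (fun m => ?_), ?_⟩, fun g h => ?_⟩
  · -- `p^m • a_m = 0`
    have h := kummerLiftSeq_mem W p v P hP σ m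
    rw [mem_geomTorsion_iff, natCast_zsmul] at h
    exact h
  · -- `p • a_{m+1} = a_m`
    apply pointsMap_injective W v
    rw [map_nsmul, pointsMap_kummerLiftSeq, pointsMap_kummerLiftSeq, ← natCast_zsmul, zsmul_sub,
      ← smul_zsmul_localPoints, p_zsmul_divSeq_succ]
  · -- continuity: coordinatewise, into the discrete `E(ℚ̄)`
    refine continuous_induced_rng.2 (continuous_pi fun m => ?_)
    exact continuous_subtype_val.comp (continuous_of_discreteTopology.comp
      (((continuous_smul_of_isOpen_stabilizer (divSeq W p v P m)
        (W.isOpen_stabilizer_localPoints (Place.Completion v) (divSeq W p v P m))).sub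
        continuous_const).subtype_mk _))
  · -- crossed homomorphism: `a(gh) = a(g) + g a(h)` componentwise
    apply TateModule.ext
    intro m
    rw [map_add, ContinuousRep.toTopRep_ρ_apply, tateLocalRep_apply_apply,
      TateModule.proj_smul_of_distribMulAction]
    change kummerLiftSeq W p v P hP (g * h) m =
      kummerLiftSeq W p v P hP g m +
        absGaloisRestrict ℚ (Place.Completion v) g • kummerLiftSeq W p v P hP h m
    apply pointsMap_injective W v
    rw [map_add, pointsMap_kummerLiftSeq, pointsMap_kummerLiftSeq, ← resGal_eq_absGaloisRestrict,
      pointsMap_smul, pointsMap_kummerLiftSeq, mul_smul, smul_sub]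
    abel

/-- Components of the lifted Kummer cocycle: `(η σ)_m = θ_{p^m}⁻¹(σ R_m − R_m)`. [folklore] -/
@[simp] theorem proj_kummerLiftCocycle (P : localPoints W (Place.Completion v))
    (hP : P ∈ MulAction.fixedPoints (absoluteGaloisGroup (Place.Completion v))
      (localPoints W (Place.Completion v)))
    (σ : absoluteGaloisGroup (Place.Completion v)) (m : ℕ) :
    TateModule.proj p m ((kummerLiftCocycle W p v P hP).1 σ) = kummerLiftSeq W p v P hP σ m := rfl

/-- `p^k · p • R_{k+1} ∈ E(ℚ_v)` (it is `P`). [folklore] -/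
theorem pow_mul_zsmul_divSeq_succ_mem (P : localPoints W (Place.Completion v))
    (hP : P ∈ MulAction.fixedPoints (absoluteGaloisGroup (Place.Completion v))
      (localPoints W (Place.Completion v))) (k : ℕ) :
    ((p : ℤ) ^ k * (p : ℤ)) • divSeq W p v P (k + 1) ∈
      MulAction.fixedPoints (absoluteGaloisGroup (Place.Completion v))
        (localPoints W (Place.Completion v)) := by
  rw [← pow_succ, pow_zsmul_divSeq]
  exact hP

omit [W.IsElliptic] in
/-- `(p^k · p : ℤ) ≠ 0`. [folklore] -/
theorem pow_mul_ne_zero (k : ℕ) : (p : ℤ) ^ k * (p : ℤ) ≠ 0 :=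
  mul_ne_zero (pow_ne_zero k (Int.natCast_ne_zero.mpr hp.out.ne_zero))
    (Int.natCast_ne_zero.mpr hp.out.ne_zero)

/-- **`π_{k+1,*}` of the lifted cocycle is the Kummer class of `R_{k+1}` at level `p^{k+1}`.**
[folklore] -/
theorem tateLocalMap_kummerLiftCocycle (k : ℕ) (P : localPoints W (Place.Completion v))
    (hP : P ∈ MulAction.fixedPoints (absoluteGaloisGroup (Place.Completion v))
      (localPoints W (Place.Completion v))) :
    tateLocalMap W p k v (oneCocycleClass (tateLocalRep W p v).toTopRep (kummerLiftCocycle W p v P hP)) =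
      W.localKummerClass ((p : ℤ) ^ k * (p : ℤ)) (pow_mul_ne_zero p k) (divSeq W p v P (k + 1))
        (pow_mul_zsmul_divSeq_succ_mem W p v P hP k) := by
  have hc : pushCocycle W p k v (kummerLiftCocycle W p v P hP) =
      W.localKummerCocycle ((p : ℤ) ^ k * (p : ℤ)) (pow_mul_ne_zero p k) (divSeq W p v P (k + 1))
        (pow_mul_zsmul_divSeq_succ_mem W p v P hP k) := by
    apply Subtype.ext
    apply ContinuousMap.ext
    intro σ
    apply Subtype.ext
    apply pointsMap_injective W v
    show pointsMap W (Place.Completion v) (kummerLiftSeq W p v P hP σ (k + 1)) = _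
    rw [pointsMap_kummerLiftSeq, pointsMap_localKummerCocycle_apply]
  rw [tateLocalMap_oneCocycleClass, hc]
  rfl

/-- **`π_{1,*}` of the lifted cocycle is the Kummer class of `R_1` at level `p`.** [folklore] -/
theorem tateLocalMapOne_kummerLiftCocycle (P : localPoints W (Place.Completion v))
    (hP : P ∈ MulAction.fixedPoints (absoluteGaloisGroup (Place.Completion v))
      (localPoints W (Place.Completion v)))
    (h1 : (p : ℤ) • divSeq W p v P 1 ∈
      MulAction.fixedPoints (absoluteGaloisGroup (Place.Completion v))
        (localPoints W (Place.Completion v))) :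
    tateLocalMapOne W p v
        (oneCocycleClass (tateLocalRep W p v).toTopRep (kummerLiftCocycle W p v P hP)) =
      W.localKummerClass (p : ℤ) (Int.natCast_ne_zero.mpr hp.out.ne_zero) (divSeq W p v P 1) h1 := by
  have hc : pushCocycleOne W p v (kummerLiftCocycle W p v P hP) =
      W.localKummerCocycle (p : ℤ) (Int.natCast_ne_zero.mpr hp.out.ne_zero) (divSeq W p v P 1)
        h1 := by
    apply Subtype.ext
    apply ContinuousMap.ext
    intro σ
    apply Subtype.ext
    apply pointsMap_injective W v
    show pointsMap W (Place.Completion v) (kummerLiftSeq W p v P hP σ 1) = _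
    rw [pointsMap_kummerLiftSeq, pointsMap_localKummerCocycle_apply]
  rw [tateLocalMapOne_oneCocycleClass, hc]
  rfl

/-! ### The inclusions -/

/-- **The local Kummer condition at level `p^{k+1}` lies in the propagated structure**, at every
place `v` of `ℚ`: `im(E(ℚ_v)/p^{k+1} → H¹(ℚ_v, E[p^{k+1}])) ≤ im(H¹(ℚ_v, T_pE) → H¹(ℚ_v, E[p^{k+1}]))`
(a Kummer class `κ_v(Q)` is the `π_{k+1}`-push-forward of the lifted cocycle along a division
sequence below `p^{k+1}Q ∈ E(ℚ_v)`). [cite: Rubin2011, §3.1 (p. 29)] -/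
theorem kummerSelmerStructure_le_propagatedSelmerStructure (k : ℕ) :
    W.kummerSelmerStructure ((p : ℤ) ^ k * (p : ℤ)) v ≤ propagatedSelmerStructure W p k v := by
  intro c hc
  rw [kummerSelmerStructure_apply] at hc
  obtain ⟨Q, hQ, rfl⟩ :=
    (W.mem_kummerLocalConditionAt_iff_exists_eq_localKummerClass _ (pow_mul_ne_zero p k) c).mp hc
  refine (mem_propagatedSelmerStructure_iff W p k v _).mpr
    ⟨oneCocycleClass (tateLocalRep W p v).toTopRep (kummerLiftCocycle W p v _ hQ), ?_⟩
  rw [tateLocalMap_kummerLiftCocycle]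
  apply localKummerClass_eq_of_zsmul_eq
  rw [← pow_succ, pow_zsmul_divSeq, pow_succ]

/-- **The local Kummer condition on `E[p]` lies in the propagated structure on the residual
representation**, at every place `v` of `ℚ`:
`W.kummerSelmerStructure p v ≤ propagatedSelmerStructureOne W p v`, i.e.
`im(E(ℚ_v)/p → H¹(ℚ_v, E[p])) ⊆ im(H¹(ℚ_v, T_pE) → H¹(ℚ_v, E[p])) = 𝓕̄_v` — the input of the residual
coisotropy of `𝓕_can` (Sakamoto Def. 3.8; skel/T-a3.md §6 (a)). [cite: Sakamoto2024, Def. 3.8 (p. 924)]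
[cite: Rubin2011, §3.1 (p. 29)] -/
theorem kummerSelmerStructure_le_propagatedSelmerStructureOne :
    W.kummerSelmerStructure (p : ℤ) v ≤ propagatedSelmerStructureOne W p v := by
  intro c hc
  rw [kummerSelmerStructure_apply] at hc
  obtain ⟨Q, hQ, rfl⟩ := (W.mem_kummerLocalConditionAt_iff_exists_eq_localKummerClass _
    (Int.natCast_ne_zero.mpr hp.out.ne_zero) c).mp hc
  have h1 : (p : ℤ) • divSeq W p v ((p : ℤ) • Q) 1 ∈
      MulAction.fixedPoints (absoluteGaloisGroup (Place.Completion v))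
        (localPoints W (Place.Completion v)) := by
    rw [p_zsmul_divSeq_succ, divSeq_zero]
    exact hQ
  refine (mem_propagatedSelmerStructureOne_iff W p v _).mpr
    ⟨oneCocycleClass (tateLocalRep W p v).toTopRep (kummerLiftCocycle W p v _ hQ), ?_⟩
  rw [tateLocalMapOne_kummerLiftCocycle W p v _ hQ h1]
  apply localKummerClass_eq_of_zsmul_eq
  rw [p_zsmul_divSeq_succ, divSeq_zero]

/-- **N11 reading (`p = 3`)**: at every place, the `3`-descent local condition is contained in the
canonical structure's residual condition `𝓕̄_v` on `E[3]`. [cite: Sakamoto2024, Def. 3.8 (p. 924)] -/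
theorem kummerSelmerStructure_three_le_propagatedSelmerStructureOne :
    W.kummerSelmerStructure (3 : ℤ) v ≤ propagatedSelmerStructureOne W 3 v := by
  haveI : Fact (Nat.Prime 3) := ⟨Nat.prime_three⟩
  exact kummerSelmerStructure_le_propagatedSelmerStructureOne W 3 v

end Summit.BirchSwinnertonDyer.Rank1Residual.GaloisImage

end
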